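import Mathlib

/-!
# Hodge-locus census (V3-XT, N = 1), conductor-2 / conductor-3 columns — engine B's closed forms for the level counts, proved for every class

certified instances and evidence bearing on the general Hodge conjecture; no claim.

Companion to `HodgeLocusCensusConductor23LatticeAnchors` (engine B, pub-hlocus-abs-2 gen 42), which checks the level
counts r(m; C) of the conductor-2 / conductor-3 rows by `decide` on 11 anchor discriminants.  Here the two CLOSED FORMS
of engine B (code/abs_engineB/v3B/xt/n1cond23/DERIVATION-QC23-B.md §3) are proved as statements about the lattices
themselves, for EVERY class (no enumeration):

* ℓ = 2.  Hurwitz order O₂ ⊂ (−1,−1); in the coordinates i, j, k its trace-zero lattice is S(O₂) = {w ∈ ℤ³ : w₁ ≡ w₂ ≡ w₃ (2)}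
  (`S2`), nrd = x₁² + x₂² + x₃², and the roots of −3 are the 8 sign vectors ε ∈ {±1}³.  For c = (x₁, x₂, x₃) with all
  x_a odd (every root of norm |D| ≡ 3 (mod 4), `…LatticeAnchors.odd_of_root2`) and the level-m lattice L(c, m) = ℤc + 2^m S(O₂)
  (`InLat (2^m) S2 · c`):
  `inLat2_iff`     s ∈ L(c, m) ⟺ 2^{m+1} ∣ x₁s₂ − x₂s₁ and 2^{m+1} ∣ x₁s₃ − x₃s₁ (any s ∈ ℤ³);
  `sq_dvd_iff`     x, y odd: 2^{m+2} ∣ x² − y² ⟺ 2^{m+1} ∣ x − y or 2^{m+1} ∣ x + y;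
  `level2_zero`    every odd vector, in particular every sign vector, lies in L(c, 0)            — r₋₃(0; C) = 8;
  `level2_iff`     some sign vector lies in L(c, m) ⟺ 2^{m+2} ∣ x₁² − x₂² and 2^{m+2} ∣ x₁² − x₃²;
  `level2_unique`  (m ≥ 1) two sign vectors in L(c, m) are equal or opposite                       — r₋₃(m; C) ∈ {0, 2};
  hence r₋₃(m; C) = 2·[2^{m+2} ∣ gcd(x₁² − x₂², x₁² − x₃²)] for m ≥ 1 and, with v = v₂(gcd(x₁² − x₂², x₁² − x₃²)) ≥ 3 (odd squares
  agree mod 8), (3/2) Σ_m r₋₃(m; C) = 12 + 3(v − 2) = 6 + 3v: engine B's closed form, e ≡ 0 (mod 3), e ≥ 15.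
* ℓ = 3.  Maximal order O₃ = ℤ⟨1, i, (1+j)/2, (i+k)/2⟩ ⊂ (−1,−3); S(O₃) = {w : w₁ ≡ w₃ (2)} (`S3`), nrd = y₁² + 3y₂² + 3y₃², and the
  roots of −4 are (±2, 0, 0), (±1, 0, ±1) (`IsRoot4`).  For c = (y₁, y₂, y₃) with y₁ ≡ y₃ (2) and 3 ∤ y₁ (norm ≡ 1 mod 3, every
  3-inert fundamental D) and L(c, m) = ℤc + 3^m S(O₃):
  `inLat3_iff`     s ∈ L(c, m) ⟺ ∃ b, 3^m ∣ s − bc componentwise (for s₁ ≡ s₃ (2) the parity condition is automatic);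
  `level3_zero`    every root of −4 lies in L(c, 0)                                                 — r₋₄(0; C) = 6;
  `level3_type`    (m ≥ 1) a root s of −4 in L(c, m) has 3 ∣ s₁y₃ − s₃y₁ (its type: 3 ∣ y₃, 3 ∣ y₃ − y₁ or 3 ∣ y₃ + y₁);
  `level3_iff`     (m ≥ 1) some root of −4 lies in L(c, m) ⟺ 3^m ∣ y₂ and 3^m ∣ y₃(y₃² − y₁²);
  `level3_unique`  (m ≥ 1) two roots of −4 in L(c, m) are equal or opposite                         — r₋₄(m; C) ∈ {0, 2};
  hence Σ_m r₋₄(m; C) = 6 + 2·min(v₃(y₂), v₃(y₃(y₃² − y₁²))): engine B's closed form, e even, e ≥ 6, e ≥ 8 ⟺ 3 ∣ y₂.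
The identification of these level counts with the tangency depth e(C) = v(j(C) − j*) = ½ Σ_n #Iso_n(E_C, E*) (Gross–Zagier 1985
Prop. 2.3, Gross 1986 Prop. 3.3) is NOT proved here; it is certified on every class with |D| ≤ 6000 (ℓ = 2) / 5000 (ℓ = 3) by kit jobs
j161536 / j161538 (three engine-B sources agreeing with the exact class polynomials) and, independently, by engine A's enumeration
test T18a (606/606 + 571/571 rows).  Proofs: `ring`, `linear_combination`, `omega`, coprimality (`IsCoprime`) — no enumeration, no `decide`.
-/

set_option linter.dupNamespace false

namespace Summit.HodgeConjecture.HodgeConjecture.HodgeLocus.Census.Conductor23ClosedForms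

/-- integer 3-vectors (coordinates on i, j, k) -/
abbrev V3 := ℤ × ℤ × ℤ

/-- S(O₂): all coordinates of the same parity -/
abbrev S2 (w : V3) : Prop := (2 : ℤ) ∣ w.1 - w.2.1 ∧ (2 : ℤ) ∣ w.1 - w.2.2

/-- S(O₃): first and third coordinate of the same parity -/
abbrev S3 (w : V3) : Prop := (2 : ℤ) ∣ w.1 - w.2.2

/-- membership of s in the level lattice ℤ c + q S -/
abbrev InLat (q : ℤ) (S : V3 → Prop) (s c : V3) : Prop :=
  ∃ b : ℤ, ∃ w : V3, S w ∧ s.1 = b * c.1 + q * w.1 ∧ s.2.1 = b * c.2.1 + q * w.2.1 ∧ s.2.2 = b * c.2.2 + q * w.2.2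

/-- the entries of a sign vector -/
abbrev IsSign (e : ℤ) : Prop := e = 1 ∨ e = -1

/-- the six roots of −4 in S(O₃): (±2, 0, 0), (±1, 0, ±1) -/
abbrev IsRoot4 (s₁ s₂ s₃ : ℤ) : Prop :=
  s₂ = 0 ∧ ((s₁ = 2 ∧ s₃ = 0) ∨ (s₁ = -2 ∧ s₃ = 0) ∨ (s₁ = 1 ∧ s₃ = 1) ∨ (s₁ = 1 ∧ s₃ = -1) ∨ (s₁ = -1 ∧ s₃ = 1) ∨ (s₁ = -1 ∧ s₃ = -1))

/-- an integer not divisible by 3 is coprime to 3 -/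
theorem isCoprime_three_of_not_dvd {x : ℤ} (hx : ¬ (3 : ℤ) ∣ x) : IsCoprime 3 x := by
  rcases (by omega : x % 3 = 1 ∨ x % 3 = 2) with h | h
  · obtain ⟨k, hk⟩ : ∃ k, x = 3 * k + 1 := ⟨x / 3, by omega⟩
    exact ⟨-k, 1, by rw [hk]; ring⟩
  · obtain ⟨k, hk⟩ : ∃ k, x = 3 * k + 2 := ⟨x / 3, by omega⟩
    exact ⟨-(2 * k + 1), 2, by rw [hk]; ring⟩

/-! ## ℓ = 2 -/

/-- ℓ = 2 membership criterion: for c with odd coordinates, s ∈ ℤc + 2^m S(O₂) iff 2^{m+1} ∣ c₁s₂ − c₂s₁ and 2^{m+1} ∣ c₁s₃ − c₃s₁ -/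
theorem inLat2_iff (m : ℕ) (s₁ s₂ s₃ c₁ c₂ c₃ : ℤ) (h1 : Odd c₁) (h2 : Odd c₂) (h3 : Odd c₃) :
    InLat (2 ^ m) S2 (s₁, s₂, s₃) (c₁, c₂, c₃) ↔
      (2 : ℤ) ^ (m + 1) ∣ c₁ * s₂ - c₂ * s₁ ∧ (2 : ℤ) ^ (m + 1) ∣ c₁ * s₃ - c₃ * s₁ := by
  obtain ⟨⟨a₁, rfl⟩, ⟨a₂, rfl⟩, ⟨a₃, rfl⟩⟩ := And.intro h1 (And.intro h2 h3)
  constructor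
  · rintro ⟨b, ⟨w₁, w₂, w₃⟩, ⟨⟨t₂, ht₂⟩, ⟨t₃, ht₃⟩⟩, e₁, e₂, e₃⟩
    dsimp only at ht₂ ht₃ e₁ e₂ e₃
    subst e₁ e₂ e₃
    obtain rfl : w₂ = w₁ - 2 * t₂ := by omega
    obtain rfl : w₃ = w₁ - 2 * t₃ := by omega
    exact ⟨⟨a₁ * (w₁ - 2 * t₂) - a₂ * w₁ - t₂, by rw [pow_succ]; ring⟩,
      ⟨a₁ * (w₁ - 2 * t₃) - a₃ * w₁ - t₃, by rw [pow_succ]; ring⟩⟩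
  · rintro ⟨g₂, g₃⟩
    have hc : IsCoprime (2 : ℤ) (2 * a₁ + 1) := ⟨-a₁, 1, by ring⟩
    have hc' : IsCoprime ((2 : ℤ) ^ (m + 1)) (2 * a₁ + 1) := hc.pow_left
    obtain ⟨u, v, huv⟩ := id hc'
    have d₁ : (2 : ℤ) ^ (m + 1) ∣ s₁ - v * s₁ * (2 * a₁ + 1) := ⟨u * s₁, by linear_combination (-s₁) * huv⟩
    have key : ∀ s c : ℤ, (2 : ℤ) ^ (m + 1) ∣ (2 * a₁ + 1) * s - c * s₁ → (2 : ℤ) ^ (m + 1) ∣ s - v * s₁ * c := by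
      intro s c g
      apply hc'.dvd_of_dvd_mul_left
      have e : (2 * a₁ + 1) * (s - v * s₁ * c) = ((2 * a₁ + 1) * s - c * s₁) + 2 ^ (m + 1) * (u * c * s₁) := by
        linear_combination (-(c * s₁)) * huv
      rw [e]
      exact dvd_add g (dvd_mul_right _ _)
    obtain ⟨q₁, hq₁⟩ := d₁
    obtain ⟨q₂, hq₂⟩ := key s₂ (2 * a₂ + 1) g₂
    obtain ⟨q₃, hq₃⟩ := key s₃ (2 * a₃ + 1) g₃
    refine ⟨v * s₁, (2 * q₁, 2 * q₂, 2 * q₃), ⟨⟨q₁ - q₂, ?_⟩, ⟨q₁ - q₃, ?_⟩⟩, ?_, ?_, ?_⟩ <;> dsimp only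
    · ring
    · ring
    · linear_combination hq₁
    · linear_combination hq₂
    · linear_combination hq₃

/-- odd squares: 2^{m+2} ∣ x² − y² iff 2^{m+1} ∣ x − y or 2^{m+1} ∣ x + y -/
theorem sq_dvd_iff (m : ℕ) (x y : ℤ) (hx : Odd x) (hy : Odd y) :
    (2 : ℤ) ^ (m + 2) ∣ x ^ 2 - y ^ 2 ↔ (2 : ℤ) ^ (m + 1) ∣ x - y ∨ (2 : ℤ) ^ (m + 1) ∣ x + y := by
  obtain ⟨a, rfl⟩ := hx
  obtain ⟨a', rfl⟩ := hy
  have epow : (2 : ℤ) ^ (m + 2) = 2 ^ (m + 1) * 2 := by ring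
  constructor
  · intro h
    rcases Int.even_or_odd (a - a') with ⟨t, ht⟩ | ⟨t, ht⟩
    · -- a − a' even ⇒ a + a' + 1 odd: cancel the factor x + y = 2(a + a' + 1) down to 2
      left
      have hodd : IsCoprime ((2 : ℤ) ^ (m + 1)) (a + a' + 1) :=
        (show IsCoprime (2 : ℤ) (a + a' + 1) from ⟨-(a' + t), 1, by linear_combination ht⟩).pow_left
      have h2 : (2 : ℤ) ^ (m + 1) * 2 ∣ ((2 * a + 1) - (2 * a' + 1)) * (a + a' + 1) * 2 := by
        have e : ((2 * a + 1) - (2 * a' + 1)) * (a + a' + 1) * 2 = (2 * a + 1) ^ 2 - (2 * a' + 1) ^ 2 := by ring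
        rw [← epow, e]; exact h
      have h3 := (mul_dvd_mul_iff_right (two_ne_zero : (2 : ℤ) ≠ 0)).mp h2
      rw [mul_comm] at h3
      exact hodd.dvd_of_dvd_mul_left h3
    · -- a − a' odd: cancel the factor x − y = 2(a − a') down to 2
      right
      have hodd : IsCoprime ((2 : ℤ) ^ (m + 1)) (a - a') :=
        (show IsCoprime (2 : ℤ) (a - a') from ⟨-t, 1, by linear_combination ht⟩).pow_left
      have h2 : (2 : ℤ) ^ (m + 1) * 2 ∣ ((2 * a + 1) + (2 * a' + 1)) * (a - a') * 2 := by
        have e : ((2 * a + 1) + (2 * a' + 1)) * (a - a') * 2 = (2 * a + 1) ^ 2 - (2 * a' + 1) ^ 2 := by ring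
        rw [← epow, e]; exact h
      have h3 := (mul_dvd_mul_iff_right (two_ne_zero : (2 : ℤ) ≠ 0)).mp h2
      rw [mul_comm] at h3
      exact hodd.dvd_of_dvd_mul_left h3
  · rintro (⟨q, hq⟩ | ⟨q, hq⟩)
    · exact ⟨q * (a + a' + 1), by linear_combination (2 * (a + a' + 1)) * hq⟩
    · exact ⟨q * (a - a'), by linear_combination (2 * (a - a')) * hq⟩

/-- r₋₃(0; C) = 8: every vector with odd coordinates — in particular each of the 8 sign vectors — lies in ℤc + S(O₂) -/
theorem level2_zero (s₁ s₂ s₃ c₁ c₂ c₃ : ℤ) (hs1 : Odd s₁) (hs2 : Odd s₂) (hs3 : Odd s₃)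
    (h1 : Odd c₁) (h2 : Odd c₂) (h3 : Odd c₃) : InLat (2 ^ 0) S2 (s₁, s₂, s₃) (c₁, c₂, c₃) := by
  rw [inLat2_iff 0 _ _ _ _ _ _ h1 h2 h3]
  obtain ⟨⟨a₁, rfl⟩, ⟨a₂, rfl⟩, ⟨a₃, rfl⟩⟩ := And.intro h1 (And.intro h2 h3)
  obtain ⟨⟨b₁, rfl⟩, ⟨b₂, rfl⟩, ⟨b₃, rfl⟩⟩ := And.intro hs1 (And.intro hs2 hs3)
  exact ⟨⟨2 * a₁ * b₂ + a₁ + b₂ - 2 * a₂ * b₁ - a₂ - b₁, by ring⟩, ⟨2 * a₁ * b₃ + a₁ + b₃ - 2 * a₃ * b₁ - a₃ - b₁, by ring⟩⟩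

/-- sign bookkeeping: k ∣ c₁e₂ − c₂e₁ with e₁, e₂ = ±1 means k ∣ c₁ − c₂ or k ∣ c₁ + c₂ -/
theorem sign_cases {k c₁ c₂ e₁ e₂ : ℤ} (he1 : IsSign e₁) (he2 : IsSign e₂) (g : k ∣ c₁ * e₂ - c₂ * e₁) :
    k ∣ c₁ - c₂ ∨ k ∣ c₁ + c₂ := by
  rcases he1 with rfl | rfl <;> rcases he2 with rfl | rfl
  · left; have e : c₁ * 1 - c₂ * 1 = c₁ - c₂ := by ring
    rwa [e] at g
  · right; have e : c₁ * (-1) - c₂ * 1 = -(c₁ + c₂) := by ring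
    rwa [e, dvd_neg] at g
  · right; have e : c₁ * 1 - c₂ * (-1) = c₁ + c₂ := by ring
    rwa [e] at g
  · left; have e : c₁ * (-1) - c₂ * (-1) = -(c₁ - c₂) := by ring
    rwa [e, dvd_neg] at g

/-- converse sign bookkeeping with e₁ = 1 -/
theorem sign_exists {k c₁ c₂ : ℤ} (g : k ∣ c₁ - c₂ ∨ k ∣ c₁ + c₂) : ∃ e₂, IsSign e₂ ∧ k ∣ c₁ * e₂ - c₂ * 1 := by
  rcases g with g | g
  · refine ⟨1, Or.inl rfl, ?_⟩
    have e : c₁ * 1 - c₂ * 1 = c₁ - c₂ := by ring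
    rwa [e]
  · refine ⟨-1, Or.inr rfl, ?_⟩
    have e : c₁ * (-1) - c₂ * 1 = -(c₁ + c₂) := by ring
    rwa [e, dvd_neg]

/-- ℓ = 2 survival criterion: some root of −3 (sign vector) survives to level m iff x₁² ≡ x₂² ≡ x₃² (mod 2^{m+2}) -/
theorem level2_iff (m : ℕ) (c₁ c₂ c₃ : ℤ) (h1 : Odd c₁) (h2 : Odd c₂) (h3 : Odd c₃) :
    (∃ ε₁ ε₂ ε₃ : ℤ, IsSign ε₁ ∧ IsSign ε₂ ∧ IsSign ε₃ ∧ InLat (2 ^ m) S2 (ε₁, ε₂, ε₃) (c₁, c₂, c₃)) ↔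
      (2 : ℤ) ^ (m + 2) ∣ c₁ ^ 2 - c₂ ^ 2 ∧ (2 : ℤ) ^ (m + 2) ∣ c₁ ^ 2 - c₃ ^ 2 := by
  rw [sq_dvd_iff m c₁ c₂ h1 h2, sq_dvd_iff m c₁ c₃ h1 h3]
  constructor
  · rintro ⟨ε₁, ε₂, ε₃, e1, e2, e3, hL⟩
    rw [inLat2_iff m _ _ _ _ _ _ h1 h2 h3] at hL
    exact ⟨sign_cases e1 e2 hL.1, sign_cases e1 e3 hL.2⟩
  · rintro ⟨d2, d3⟩
    obtain ⟨e₂, he2, g2⟩ := sign_exists d2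
    obtain ⟨e₃, he3, g3⟩ := sign_exists d3
    refine ⟨1, e₂, e₃, Or.inl rfl, he2, he3, ?_⟩
    rw [inLat2_iff m _ _ _ _ _ _ h1 h2 h3]
    exact ⟨g2, g3⟩

/-- ℓ = 2 multiplicity: for m ≥ 1 two sign vectors in L(c, m) are equal or opposite, so r₋₃(m; C) ∈ {0, 2} -/
theorem level2_unique (m : ℕ) (hm : 1 ≤ m) (c₁ c₂ c₃ : ℤ) (h1 : Odd c₁) (h2 : Odd c₂) (h3 : Odd c₃)
    (ε₁ ε₂ ε₃ δ₁ δ₂ δ₃ : ℤ) (e1 : IsSign ε₁) (e2 : IsSign ε₂) (e3 : IsSign ε₃) (d1 : IsSign δ₁) (d2 : IsSign δ₂) (d3 : IsSign δ₃)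
    (hε : InLat (2 ^ m) S2 (ε₁, ε₂, ε₃) (c₁, c₂, c₃)) (hδ : InLat (2 ^ m) S2 (δ₁, δ₂, δ₃) (c₁, c₂, c₃)) :
    (δ₁, δ₂, δ₃) = (ε₁, ε₂, ε₃) ∨ (δ₁, δ₂, δ₃) = (-ε₁, -ε₂, -ε₃) := by
  rw [inLat2_iff m _ _ _ _ _ _ h1 h2 h3] at hε hδ
  obtain ⟨⟨g2, g3⟩, ⟨k2, k3⟩⟩ := And.intro hε hδ
  have h4 : (4 : ℤ) ∣ 2 ^ (m + 1) := by
    obtain ⟨n, rfl⟩ : ∃ n, m = n + 1 := ⟨m - 1, by omega⟩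
    exact ⟨2 ^ n, by ring⟩
  have g2' := dvd_trans h4 g2; have g3' := dvd_trans h4 g3; have k2' := dvd_trans h4 k2; have k3' := dvd_trans h4 k3
  obtain ⟨⟨a₁, rfl⟩, ⟨a₂, rfl⟩, ⟨a₃, rfl⟩⟩ := And.intro h1 (And.intro h2 h3)
  rcases e1 with rfl | rfl <;> rcases e2 with rfl | rfl <;> rcases e3 with rfl | rfl <;>
    rcases d1 with rfl | rfl <;> rcases d2 with rfl | rfl <;> rcases d3 with rfl | rfl <;>
    first | (left; decide) | (right; decide) | (exfalso; omega)

/-! ## ℓ = 3 -/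

/-- ℓ = 3 membership criterion: for s₁ ≡ s₃, c₁ ≡ c₃ (mod 2), s ∈ ℤc + 3^m S(O₃) iff s ≡ bc (mod 3^m) componentwise for some b -/
theorem inLat3_iff (m : ℕ) (s₁ s₂ s₃ c₁ c₂ c₃ : ℤ) (hs : (2 : ℤ) ∣ s₁ - s₃) (hc : (2 : ℤ) ∣ c₁ - c₃) :
    InLat (3 ^ m) S3 (s₁, s₂, s₃) (c₁, c₂, c₃) ↔
      ∃ b : ℤ, (3 : ℤ) ^ m ∣ s₁ - b * c₁ ∧ (3 : ℤ) ^ m ∣ s₂ - b * c₂ ∧ (3 : ℤ) ^ m ∣ s₃ - b * c₃ := by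
  constructor
  · rintro ⟨b, ⟨w₁, w₂, w₃⟩, -, e₁, e₂, e₃⟩
    dsimp only at e₁ e₂ e₃
    exact ⟨b, ⟨w₁, by linear_combination e₁⟩, ⟨w₂, by linear_combination e₂⟩, ⟨w₃, by linear_combination e₃⟩⟩
  · rintro ⟨b, ⟨q₁, hq₁⟩, ⟨q₂, hq₂⟩, ⟨q₃, hq₃⟩⟩
    have h32 : IsCoprime (2 : ℤ) ((3 : ℤ) ^ m) := (show IsCoprime (2 : ℤ) 3 from ⟨-1, 1, by norm_num⟩).pow_right
    have hpar : (2 : ℤ) ∣ q₁ - q₃ := by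
      apply h32.dvd_of_dvd_mul_left
      have e : (3 : ℤ) ^ m * (q₁ - q₃) = (s₁ - s₃) - b * (c₁ - c₃) := by linear_combination hq₃ - hq₁
      rw [e]
      exact dvd_sub hs (Dvd.dvd.mul_left hc b)
    refine ⟨b, (q₁, q₂, q₃), hpar, ?_, ?_, ?_⟩ <;> dsimp only
    · linear_combination hq₁
    · linear_combination hq₂
    · linear_combination hq₃

/-- the roots of −4 satisfy the parity condition of S(O₃) -/
theorem root4_parity {s₁ s₂ s₃ : ℤ} (hs : IsRoot4 s₁ s₂ s₃) : (2 : ℤ) ∣ s₁ - s₃ := by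
  rcases hs with ⟨-, h | h | h | h | h | h⟩ <;> obtain ⟨rfl, rfl⟩ := h <;> norm_num

/-- r₋₄(0; C) = 6: every root of −4 lies in ℤc + S(O₃) -/
theorem level3_zero (s₁ s₂ s₃ c₁ c₂ c₃ : ℤ) (hs : IsRoot4 s₁ s₂ s₃) (hc : (2 : ℤ) ∣ c₁ - c₃) :
    InLat (3 ^ 0) S3 (s₁, s₂, s₃) (c₁, c₂, c₃) := by
  rw [inLat3_iff 0 _ _ _ _ _ _ (root4_parity hs) hc]
  exact ⟨0, by simp⟩

/-- ℓ = 3 type of a surviving root (m ≥ 1): 3 ∣ s₁y₃ − s₃y₁, i.e. 3 ∣ y₃ for (±2,0,0), 3 ∣ y₃ − y₁ for ±(1,0,1), 3 ∣ y₃ + y₁ for ±(1,0,−1) -/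
theorem level3_type (m : ℕ) (hm : 1 ≤ m) (s₁ s₂ s₃ c₁ c₂ c₃ : ℤ) (hs : IsRoot4 s₁ s₂ s₃) (hc : (2 : ℤ) ∣ c₁ - c₃)
    (hL : InLat (3 ^ m) S3 (s₁, s₂, s₃) (c₁, c₂, c₃)) : (3 : ℤ) ∣ s₁ * c₃ - s₃ * c₁ := by
  rw [inLat3_iff m _ _ _ _ _ _ (root4_parity hs) hc] at hL
  obtain ⟨b, ⟨q₁, hq₁⟩, -, ⟨q₃, hq₃⟩⟩ := hL
  have h3m : (3 : ℤ) ∣ 3 ^ m := dvd_pow_self 3 (by omega)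
  have hb : ¬ (3 : ℤ) ∣ b := by
    rintro ⟨k, rfl⟩
    have h3s : (3 : ℤ) ∣ s₁ := by
      have e : s₁ = 3 * (k * c₁) + 3 ^ m * q₁ := by linear_combination hq₁
      rw [e]
      exact dvd_add (dvd_mul_right _ _) (Dvd.dvd.mul_right h3m _)
    rcases hs with ⟨-, h | h | h | h | h | h⟩ <;> obtain ⟨rfl, -⟩ := h <;> omega
  have hT : (3 : ℤ) ∣ b * (s₁ * c₃ - s₃ * c₁) := by
    have e : b * (s₁ * c₃ - s₃ * c₁) = 3 ^ m * (s₃ * q₁ - s₁ * q₃) := by linear_combination s₃ * hq₁ - s₁ * hq₃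
    rw [e]
    exact Dvd.dvd.mul_right h3m _
  exact (isCoprime_three_of_not_dvd hb).dvd_of_dvd_mul_left hT

/-- ℓ = 3 survival criterion (m ≥ 1, 3 ∤ y₁): some root of −4 survives to level m iff 3^m ∣ y₂ and 3^m ∣ y₃(y₃² − y₁²) -/
theorem level3_iff (m : ℕ) (hm : 1 ≤ m) (c₁ c₂ c₃ : ℤ) (hc : (2 : ℤ) ∣ c₁ - c₃) (h3 : ¬ (3 : ℤ) ∣ c₁) :
    (∃ s₁ s₂ s₃ : ℤ, IsRoot4 s₁ s₂ s₃ ∧ InLat (3 ^ m) S3 (s₁, s₂, s₃) (c₁, c₂, c₃)) ↔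
      (3 : ℤ) ^ m ∣ c₂ ∧ (3 : ℤ) ^ m ∣ c₃ * (c₃ ^ 2 - c₁ ^ 2) := by
  have h3m : (3 : ℤ) ∣ 3 ^ m := dvd_pow_self 3 (by omega)
  have hcop : IsCoprime ((3 : ℤ) ^ m) c₁ := (isCoprime_three_of_not_dvd h3).pow_left
  constructor
  · rintro ⟨s₁, s₂, s₃, hs, hL⟩
    rw [inLat3_iff m _ _ _ _ _ _ (root4_parity hs) hc] at hL
    obtain ⟨b, d₁, d₂, d₃⟩ := hL
    -- b is a unit mod 3: if 3 ∣ b then 3 ∣ s₁ ∈ {±1, ±2}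
    have hb : ¬ (3 : ℤ) ∣ b := by
      rintro ⟨k, rfl⟩
      obtain ⟨q₁, hq₁⟩ := d₁
      have h3s : (3 : ℤ) ∣ s₁ := by
        have e : s₁ = 3 * (k * c₁) + 3 ^ m * q₁ := by linear_combination hq₁
        rw [e]
        exact dvd_add (dvd_mul_right _ _) (Dvd.dvd.mul_right h3m _)
      rcases hs with ⟨-, h | h | h | h | h | h⟩ <;> obtain ⟨rfl, -⟩ := h <;> omega
    have hbm : IsCoprime ((3 : ℤ) ^ m) b := (isCoprime_three_of_not_dvd hb).pow_left
    have hc2 : (3 : ℤ) ^ m ∣ c₂ := by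
      have e0 : s₂ = 0 := hs.1
      rw [e0] at d₂
      refine hbm.dvd_of_dvd_mul_left ?_
      have e : b * c₂ = -(0 - b * c₂) := by ring
      rw [e, dvd_neg]; exact d₂
    refine ⟨hc2, ?_⟩
    obtain ⟨rfl, h | h | h | h | h | h⟩ := hs <;> obtain ⟨rfl, rfl⟩ := h
    · -- s = (2, 0, 0): 3^m ∣ c₃
      have hc3 : (3 : ℤ) ^ m ∣ c₃ := by
        refine hbm.dvd_of_dvd_mul_left ?_
        have e : b * c₃ = -(0 - b * c₃) := by ring
        rw [e, dvd_neg]; exact d₃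
      exact Dvd.dvd.mul_right hc3 _
    · -- s = (−2, 0, 0)
      have hc3 : (3 : ℤ) ^ m ∣ c₃ := by
        refine hbm.dvd_of_dvd_mul_left ?_
        have e : b * c₃ = -(0 - b * c₃) := by ring
        rw [e, dvd_neg]; exact d₃
      exact Dvd.dvd.mul_right hc3 _
    · -- s = (1, 0, 1): 3^m ∣ c₃ − c₁
      have hd : (3 : ℤ) ^ m ∣ c₃ - c₁ := by
        refine hbm.dvd_of_dvd_mul_left ?_
        have e : b * (c₃ - c₁) = (1 - b * c₁) - (1 - b * c₃) := by ring
        rw [e]; exact dvd_sub d₁ d₃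
      have e : c₃ * (c₃ ^ 2 - c₁ ^ 2) = (c₃ - c₁) * (c₃ * (c₃ + c₁)) := by ring
      rw [e]; exact Dvd.dvd.mul_right hd _
    · -- s = (1, 0, −1): 3^m ∣ c₃ + c₁
      have hd : (3 : ℤ) ^ m ∣ c₃ + c₁ := by
        refine hbm.dvd_of_dvd_mul_left ?_
        have e : b * (c₃ + c₁) = -((1 - b * c₁) + (-1 - b * c₃)) := by ring
        rw [e, dvd_neg]; exact dvd_add d₁ d₃
      have e : c₃ * (c₃ ^ 2 - c₁ ^ 2) = (c₃ + c₁) * (c₃ * (c₃ - c₁)) := by ring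
      rw [e]; exact Dvd.dvd.mul_right hd _
    · -- s = (−1, 0, 1): 3^m ∣ c₃ + c₁
      have hd : (3 : ℤ) ^ m ∣ c₃ + c₁ := by
        refine hbm.dvd_of_dvd_mul_left ?_
        have e : b * (c₃ + c₁) = -((-1 - b * c₁) + (1 - b * c₃)) := by ring
        rw [e, dvd_neg]; exact dvd_add d₁ d₃
      have e : c₃ * (c₃ ^ 2 - c₁ ^ 2) = (c₃ + c₁) * (c₃ * (c₃ - c₁)) := by ring
      rw [e]; exact Dvd.dvd.mul_right hd _
    · -- s = (−1, 0, −1): 3^m ∣ c₃ − c₁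
      have hd : (3 : ℤ) ^ m ∣ c₃ - c₁ := by
        refine hbm.dvd_of_dvd_mul_left ?_
        have e : b * (c₃ - c₁) = (-1 - b * c₁) - (-1 - b * c₃) := by ring
        rw [e]; exact dvd_sub d₁ d₃
      have e : c₃ * (c₃ ^ 2 - c₁ ^ 2) = (c₃ - c₁) * (c₃ * (c₃ + c₁)) := by ring
      rw [e]; exact Dvd.dvd.mul_right hd _
  · rintro ⟨hc2, hprod⟩
    obtain ⟨u, v, huv⟩ := id hcop
    have h1v : (3 : ℤ) ^ m ∣ 1 - v * c₁ := ⟨u, by linear_combination (-1) * huv⟩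
    -- which of c₃, c₃ − c₁, c₃ + c₁ is divisible by 3 (at most one is, since 3 ∤ c₁)
    have eprod : c₃ * (c₃ ^ 2 - c₁ ^ 2) = c₃ * ((c₃ - c₁) * (c₃ + c₁)) := by ring
    rw [eprod] at hprod
    have h3prod : (3 : ℤ) ∣ c₃ * ((c₃ - c₁) * (c₃ + c₁)) := dvd_trans h3m hprod
    rcases Int.prime_three.dvd_mul.mp h3prod with k | k
    · -- 3 ∣ c₃: root (2, 0, 0) with b = 2v
      have n1 : ¬ (3 : ℤ) ∣ c₃ - c₁ := fun h => h3 (by omega)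
      have n2 : ¬ (3 : ℤ) ∣ c₃ + c₁ := fun h => h3 (by omega)
      have cop : IsCoprime ((3 : ℤ) ^ m) ((c₃ - c₁) * (c₃ + c₁)) :=
        ((isCoprime_three_of_not_dvd n1).pow_left).mul_right ((isCoprime_three_of_not_dvd n2).pow_left)
      have hc3 : (3 : ℤ) ^ m ∣ c₃ := cop.dvd_of_dvd_mul_right hprod
      refine ⟨2, 0, 0, ⟨rfl, Or.inl ⟨rfl, rfl⟩⟩, ?_⟩
      rw [inLat3_iff m 2 0 0 c₁ c₂ c₃ (by norm_num) hc]
      refine ⟨2 * v, ?_, ?_, ?_⟩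
      · have e : 2 - 2 * v * c₁ = 2 * (1 - v * c₁) := by ring
        rw [e]; exact Dvd.dvd.mul_left h1v _
      · have e : 0 - 2 * v * c₂ = -(2 * v) * c₂ := by ring
        rw [e]; exact Dvd.dvd.mul_left hc2 _
      · have e : 0 - 2 * v * c₃ = -(2 * v) * c₃ := by ring
        rw [e]; exact Dvd.dvd.mul_left hc3 _
    · rcases Int.prime_three.dvd_mul.mp k with k | k
      · -- 3 ∣ c₃ − c₁: root (1, 0, 1) with b = v
        have n1 : ¬ (3 : ℤ) ∣ c₃ := fun h => h3 (by omega)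
        have n2 : ¬ (3 : ℤ) ∣ c₃ + c₁ := fun h => h3 (by omega)
        have hd : (3 : ℤ) ^ m ∣ c₃ - c₁ :=
          ((isCoprime_three_of_not_dvd n2).pow_left).dvd_of_dvd_mul_right
            (((isCoprime_three_of_not_dvd n1).pow_left).dvd_of_dvd_mul_left hprod)
        refine ⟨1, 0, 1, ⟨rfl, Or.inr (Or.inr (Or.inl ⟨rfl, rfl⟩))⟩, ?_⟩
        rw [inLat3_iff m 1 0 1 c₁ c₂ c₃ (by norm_num) hc]
        refine ⟨v, h1v, ?_, ?_⟩
        · have e : 0 - v * c₂ = -v * c₂ := by ring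
          rw [e]; exact Dvd.dvd.mul_left hc2 _
        · have e : 1 - v * c₃ = (1 - v * c₁) - v * (c₃ - c₁) := by ring
          rw [e]; exact dvd_sub h1v (Dvd.dvd.mul_left hd _)
      · -- 3 ∣ c₃ + c₁: root (1, 0, −1) with b = v
        have n1 : ¬ (3 : ℤ) ∣ c₃ := fun h => h3 (by omega)
        have n2 : ¬ (3 : ℤ) ∣ c₃ - c₁ := fun h => h3 (by omega)
        have hd : (3 : ℤ) ^ m ∣ c₃ + c₁ :=
          ((isCoprime_three_of_not_dvd n2).pow_left).dvd_of_dvd_mul_left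
            (((isCoprime_three_of_not_dvd n1).pow_left).dvd_of_dvd_mul_left hprod)
        refine ⟨1, 0, -1, ⟨rfl, Or.inr (Or.inr (Or.inr (Or.inl ⟨rfl, rfl⟩)))⟩, ?_⟩
        rw [inLat3_iff m 1 0 (-1) c₁ c₂ c₃ (by norm_num) hc]
        refine ⟨v, h1v, ?_, ?_⟩
        · have e : 0 - v * c₂ = -v * c₂ := by ring
          rw [e]; exact Dvd.dvd.mul_left hc2 _
        · have e : -1 - v * c₃ = -(1 - v * c₁) - v * (c₃ + c₁) := by ring
          rw [e]; exact dvd_sub (dvd_neg.mpr h1v) (Dvd.dvd.mul_left hd _)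

/-- ℓ = 3 multiplicity: for m ≥ 1 and 3 ∤ y₁ two roots of −4 in L(c, m) are equal or opposite, so r₋₄(m; C) ∈ {0, 2} -/
theorem level3_unique (m : ℕ) (hm : 1 ≤ m) (c₁ c₂ c₃ : ℤ) (hc : (2 : ℤ) ∣ c₁ - c₃) (h3 : ¬ (3 : ℤ) ∣ c₁)
    (s₁ s₂ s₃ t₁ t₂ t₃ : ℤ) (hs : IsRoot4 s₁ s₂ s₃) (ht : IsRoot4 t₁ t₂ t₃)
    (hL : InLat (3 ^ m) S3 (s₁, s₂, s₃) (c₁, c₂, c₃)) (hL' : InLat (3 ^ m) S3 (t₁, t₂, t₃) (c₁, c₂, c₃)) :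
    (t₁, t₂, t₃) = (s₁, s₂, s₃) ∨ (t₁, t₂, t₃) = (-s₁, -s₂, -s₃) := by
  have a := level3_type m hm _ _ _ _ _ _ hs hc hL
  have a' := level3_type m hm _ _ _ _ _ _ ht hc hL'
  obtain ⟨rfl, h | h | h | h | h | h⟩ := hs <;> obtain ⟨rfl, rfl⟩ := h <;>
    obtain ⟨rfl, h' | h' | h' | h' | h' | h'⟩ := ht <;> obtain ⟨rfl, rfl⟩ := h' <;>
    first | (left; decide) | (right; decide) | (exfalso; omega)

end Summit.HodgeConjecture.HodgeConjecture.HodgeLocus.Census.Conductor23ClosedForms
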